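import Mathlib
import Summits.Schanuel.Schanuel.Statement
import Literature.NumberTheory.Transcendental.RoyCriterion
import Summits.Schanuel.Schanuel.Theorems.SoloBlindRoyWindow
import Summits.Schanuel.Schanuel.Theorems.SoloBlindRoy2013Dictionary
import Summits.Schanuel.Schanuel.Theorems.SoloBlindJetPointSets
import HarnessLib

/-!
# Ghidelli's bidegree small value estimate stops exactly at the Dirichlet exponent of Roy's window

`Summits/Schanuel/Schanuel/Theorems/SoloBlindGhidelli2015Dictionary.lean` (soloist
`solo-Schanuel-blind`, session 17).  Companion to `SoloBlindRoy2013Dictionary` (Roy 2013, total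
degree) for the sharper BIDEGREE estimate of L. Ghidelli, *Heights of multiprojective cycles and
small value estimates in dimension two*, tesi di laurea magistrale, Università di Pisa 2015
(advisers D. Roy, R. Dvornicich), Theorem 2.1.1 (p. 29):

> Let `γ = (ξ,η) ∈ ℂ × ℂˣ` and `β, τ, ν, δ, t₀', t₁', t > 0` with `max{t₀',t₁'} = 1`,
> `min{t₀',t₁'} = t`, `1 < τ < 1+t`, `τ < β`, `ν = 1+t+β−τ+δ`, `δ > (τ−t)(1+t−τ)/(β+1−τ)`.  If for
> all large `M` some non-zero `P_M ∈ ℤ[x,y]`, `deg_x ≤ ⌊M^{t₀'}⌋`, `deg_y ≤ ⌊M^{t₁'}⌋`,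
> `‖P_M‖ ≤ exp(M^β)`, has `max_{0 ≤ i < 3⌊M^τ⌋} |D₁ⁱP_M(ξ,η)| ≤ exp(−M^ν)` (`D₁ = ∂_x + y∂_y`), then
> `ξ, η ∈ ℚ̄` (and the small values eventually vanish).

DICTIONARY.  Restrict the data of Roy's Conjecture 2 at an admissible quintuple
(`RoyAdmissible s₀ s₁ t₀ t₁ u`: degrees `(N^{t₀}, N^{t₁})`, height `e^N`, `D`-derivatives of order
`≤ N^{s₀}`, smallness `e^{−N^u}`) to ONE point.  The window forces `t₁ < t₀`
(`royAdmissible_ranges`), so Ghidelli's scale is `M = N^{t₀}` and, comparing exponents,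

  `t₀' = 1`, `t = t₁/t₀`, `β = 1/t₀`, `τ = s₀/t₀`, `ν = u/t₀`.

Checked here for EVERY admissible quintuple:
* `ghidelli2015Dictionary_t` : `0 < t₁/t₀ < 1` — the normalisation is the one above;
* `ghidelli2015Dictionary_tau_range` : `1 < s₀/t₀ < 1 + t₁/t₀` — the hypothesis `1 < τ < 1+t`
  HOLDS on the whole window (`t₀ < s₀ < t₀+t₁`);
* the hypothesis `τ < β` reads `s₀ < 1` and FAILS (`roy2013Dictionary_not_tau_lt_beta`, unchanged);
* `ghidelli2015Dictionary_threshold_gap`, `ghidelli2015Dictionary_below_threshold` : the MAIN TERM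
  `1 + t + β − τ` of the threshold exceeds `ν` by exactly `(1 + t₀ + t₁ − u − s₀)/t₀ = σ*/t₀ > 0`,
  where `σ* = 1+t₀+t₁−u−s₀` is the sparse-translate exponent of `SoloBlindJetPointSets`
  (`sparseExponent_pos`): the threshold IS the Dirichlet exponent of the one-point problem in
  Roy's units (`u + s₀ = 1 + t₀ + t₁`), and the window sits below it by exactly the amount `σ*`
  that measures how many translates carry no content;
* `ghidelli2015Dictionary_corr_floor_pos`, `ghidelli2015Dictionary_not_threshold` : the
  correction floor `(τ−t)(1+t−τ)/(β+1−τ)` is positive on the window, so the full hypothesis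
  `ν = 1+t+β−τ+δ`, `δ >` floor, fails a fortiori (indeed for every `δ ≥ 0`);
* `ghidelli2015Dictionary_improves_roy2013` : relative to Roy 2013 (main term `2 + β − τ`,
  `SoloBlindRoy2013Dictionary`) the bidegree version lowers the threshold by exactly
  `1 − t = (t₀ − t₁)/t₀ > 0` — the whole slack `t₀ − t₁` recorded there — and what remains is `σ*`.

Reading (wall.md §3 (A)): the best proven small value estimate on `G_a × G_m` with multiplicities
(2015) begins EXACTLY at the Dirichlet exponent of its interpolation problem and concludes
degeneracy (`ξ, η ∈ ℚ̄`); Conjecture-2 data at one point lie below it by `σ* ∈ (0, s₁)`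
(`sparseExponent_pos`, `sparseExponent_lt`), where such data exist at every point
(`royJets_void_of_pointCount`).  Ghidelli names the same obstruction (p. 67): "the number of
conditions imposed on `P_N` need to be less than the dimension of the space of bihomogeneous
polynomials … the understanding of the phenomena that come out when the number of conditions
slightly exceeds the dimension of the space of polynomials should be one of the future direction of
research", and (p. 68) "conjecture 2.1.3 is a question about high-transcendence degree, while
[Theorem 2.1.1] is not".

References: L. Ghidelli, tesi di laurea magistrale, Pisa 2015, etd-06262015-164322, Thm. 2.1.1
(p. 29), §2.8 (pp. 67–68); D. Roy, *A small value estimate for `G_a × G_m`*, Mathematika 59 (2013),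
arXiv:1301.0663, Thm. 1.1; D. Roy, Acta Arith. 97 (2001), Conjecture 2.
-/

namespace Summit.Schanuel.Schanuel.Theorems

open Literature.NumberTheory.Transcendental

variable {s₀ s₁ t₀ t₁ u : ℝ}

/-- The normalisation: `t = t₁/t₀ ∈ (0, 1)`, i.e. `max{t₀', t₁'} = t₀' = 1`, `min = t`.
[this work; cite: Roy2001, (1)] -/
theorem ghidelli2015Dictionary_t (h : RoyAdmissible s₀ s₁ t₀ t₁ u) :
    0 < t₁ / t₀ ∧ t₁ / t₀ < 1 := by
  obtain ⟨h0, h1, h2, h3, -⟩ := royAdmissible_unpack h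
  obtain ⟨-, -, -, -, -, r6, -⟩ := royAdmissible_ranges h
  exact ⟨div_pos h3 h2, (div_lt_one h2).2 r6⟩

/-- Ghidelli's hypothesis `1 < τ < 1 + t` HOLDS for the dictionary: `t₀ < s₀ < t₀ + t₁`.
[this work; cite: Roy2001, (1)] -/
theorem ghidelli2015Dictionary_tau_range (h : RoyAdmissible s₀ s₁ t₀ t₁ u) :
    1 < s₀ / t₀ ∧ s₀ / t₀ < 1 + t₁ / t₀ := by
  obtain ⟨h0, h1, h2, h3, h4, g1, g2, g3, g4, g5, g6, k1, k2, k3⟩ := royAdmissible_unpack h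
  refine ⟨(one_lt_div h2).2 g2, ?_⟩
  have : 1 + t₁ / t₀ = (t₀ + t₁) / t₀ := by field_simp
  rw [this, div_lt_div_iff_of_pos_right h2]
  linarith

/-- The gap between the main term `1 + t + β − τ` of Ghidelli's threshold and `ν` is exactly
`σ*/t₀`, `σ* = 1 + t₀ + t₁ − u − s₀`. [this work] -/
theorem ghidelli2015Dictionary_threshold_gap (ht₀ : t₀ ≠ 0) :
    (1 + t₁ / t₀ + 1 / t₀ - s₀ / t₀) - u / t₀ = (1 + t₀ + t₁ - u - s₀) / t₀ := by
  field_simp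
  ring

/-- Hence `ν < 1 + t + β − τ` on the whole window: the threshold fails already at `δ = 0`, by the
margin `σ*/t₀ > 0` (`sparseExponent_pos`). [this work] -/
theorem ghidelli2015Dictionary_below_threshold (h : RoyAdmissible s₀ s₁ t₀ t₁ u) :
    u / t₀ < 1 + t₁ / t₀ + 1 / t₀ - s₀ / t₀ := by
  obtain ⟨h0, h1, h2, -⟩ := royAdmissible_unpack h
  have hgap := ghidelli2015Dictionary_threshold_gap (s₀ := s₀) (t₁ := t₁) (u := u) h2.ne'
  have hpos : 0 < (1 + t₀ + t₁ - u - s₀) / t₀ := div_pos (sparseExponent_pos h) h2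
  linarith

/-- The correction floor `(τ − t)(1 + t − τ)/(β + 1 − τ)` is positive on the window
(`t₁ < s₀ < t₀ + t₁`, `s₀ < 1 + t₀`). [this work] -/
theorem ghidelli2015Dictionary_corr_floor_pos (h : RoyAdmissible s₀ s₁ t₀ t₁ u) :
    0 < (s₀ / t₀ - t₁ / t₀) * (1 + t₁ / t₀ - s₀ / t₀) / (1 / t₀ + 1 - s₀ / t₀) := by
  obtain ⟨h0, h1, h2, h3, h4, g1, g2, g3, g4, g5, g6, k1, k2, k3⟩ := royAdmissible_unpack h
  have hτ := (ghidelli2015Dictionary_tau_range h).2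
  have hden := roy2013Dictionary_corr_denom_pos h
  have hτt : t₁ / t₀ < s₀ / t₀ := (div_lt_div_iff_of_pos_right h2).2 (by linarith)
  exact div_pos (mul_pos (by linarith) (by linarith)) hden

/-- The full threshold hypothesis `ν = 1 + t + β − τ + δ` with `δ` above the (positive) floor fails:
in fact `ν ≠ 1 + t + β − τ + δ` for every `δ ≥ 0`. [this work; cite: Ghidelli2015, Thm. 2.1.1] -/
theorem ghidelli2015Dictionary_not_threshold (h : RoyAdmissible s₀ s₁ t₀ t₁ u) {δ : ℝ}
    (hδ : 0 ≤ δ) : u / t₀ ≠ 1 + t₁ / t₀ + 1 / t₀ - s₀ / t₀ + δ := by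
  have := ghidelli2015Dictionary_below_threshold h
  intro heq
  linarith

/-- Compared with Roy 2013 (main term `2 + β − τ`), the bidegree threshold is lower by exactly
`1 − t = (t₀ − t₁)/t₀ > 0`; the residual gap to the window is `σ*/t₀`
(`ghidelli2015Dictionary_threshold_gap`). [this work] -/
theorem ghidelli2015Dictionary_improves_roy2013 (h : RoyAdmissible s₀ s₁ t₀ t₁ u) :
    (2 + 1 / t₀ - s₀ / t₀) - (1 + t₁ / t₀ + 1 / t₀ - s₀ / t₀) = (t₀ - t₁) / t₀ ∧
      0 < (t₀ - t₁) / t₀ := by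
  obtain ⟨h0, h1, h2, -⟩ := royAdmissible_unpack h
  obtain ⟨-, -, -, -, -, r6, -⟩ := royAdmissible_ranges h
  refine ⟨?_, div_pos (by linarith) h2⟩
  field_simp
  ring

#harness_tags ghidelli2015Dictionary_below_threshold

end Summit.Schanuel.Schanuel.Theorems
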